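import Mathlib
import Literature.NumberTheory.LFunctions.Zhang2022.SkeletonReductions
import HarnessLib

/-!
# Zhang (2022) §10, the four steps "Proposition 7.1 + the `Sⱼ` evaluations ⇒ (10.12), (10.13),
# (10.14), (10.16)" DISCHARGED as implications, and the size bound `𝔞 ≪ 𝓛⁴`

Topic `Literature/NumberTheory/LFunctions/Zhang2022` (Landau–Siegel adjudication tree;
verdict-neutral). Y. Zhang, *Discrete mean estimates and the Landau–Siegel zero*,
arXiv:2211.02515v1 (2022) [Zhang2022LandauSiegel], §10 «Proof of Proposition 2.4», PDF pp. 57–61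
(campaign cell siegel-zhang, plan/DISCHARGE.tsv row D02, cone C26; DAG nodes `Z22:(10.12)`,
`Z22:(10.13)`, `Z22:(10.14)`, `Z22:(10.16)`, each a display «`Θ₁(𝐚₁μ,𝐚₂ν) = (½d₁ + 2d₂ + 3/2d₃)𝔞𝔓
+ o(𝔓)`» that the manuscript obtains "by Proposition 7.1" from the three preceding evaluations
«`α⁻¹Sⱼ(𝐚₁μ,𝐚₂ν) = dⱼ𝔞 + o(1)`» (tex L2951, L3004, L3074, L3120)).

What the step uses, and what this file proves (kernel-checked; nothing asserted):

* **`frakA_le_ell_pow_four`**: `𝔞 = (6/π²)L′(1,χ)²∏_{q∣D}q/(q+1) ≤ (96e⁹/π²)·𝓛⁴` for `χ` primitive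
  and `𝓛 = log D ≥ 3` — from the tree's bound `|L′(w,χ)| ≤ 2e^{9/2}(1 + log q)log q` near `w = 1`
  (`Zhang2022.Lemma31.norm_deriv_LFunction_le_near_one`). This is the (unstated) reason the error
  term `O(E(𝐚₁,𝐚₂))`, `E = 𝔓𝓛²Σⱼ|Sⱼ|`, of Proposition 7.1 is `o(𝔓)` in §10: `Sⱼ ≪ α𝔞 ≪ 𝓛⁻⁵`.
* **`theta1_eval_of_prop71`** (generic): the skeleton node `Prop71 c′` (Proposition 7.1, CLAIM),
  eventual admissibility (7.2) of the two coefficient sequences, and the three claims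
  «`α⁻¹Sⱼ = mⱼ𝔞 + o(1)`» (explicit hypotheses, in the frame `∀ δ > 0`, for all large `D`, under (A),
  `‖α⁻¹Sⱼ − mⱼ𝔞‖ ≤ δ`) imply «`Θ₁ = (½m₁ + 2m₂ + 3/2m₃)𝔞𝔓 + o(𝔓)`» (frame: `∀ ε > 0`, …,
  `‖Θ₁ − m𝔞𝔓‖ ≤ ε𝔓`).
* **`eq1012_of`** (the instance at `(𝐚₁₁,𝐚₁₃; d₃ⱼ)`, DAG node `Z22:(10.12)`) and, in the restored
  section below, seat sz-d43's **`eq1013_of_sj`, `eq1014_of_sj`, `eq1016_of_sj`** (the instances at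
  `(𝐚₁₃,𝐚₂₁; d₄ⱼ)`, `(𝐚₁₄,𝐚₂₂; d′₅ⱼ + d₅ⱼ)`, `(𝐚₁₂,𝐚₁₄; d′₆ⱼ + d₆ⱼ)`, DAG nodes `Z22:(10.13)`,
  `(10.14)`, `(10.16)`) over the tree's constants (`Section10Defs`), with admissibility supplied by
  the skeleton's `adm72_a11 … adm72_a14` (`SkeletonReductions`).

The final section restores, with their landed signatures, the nine declarations of seat sz-d43's
`Section10Theta1Evals.lean` (p412375: `theta1_eval_of_mainMV`, `theta1_eval_of_sj`, `Ecal_nonneg`,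
`adm72_a13_a21`, `adm72_a14_a22`, `adm72_a12_a14`, `eq1013_of_sj`, `eq1014_of_sj`, `eq1016_of_sj`),
which a filing collision had removed from the tree.

**Every proposition involved is a CLAIM of an unrefereed manuscript under adjudication; this file
proves implications between claims and one unconditional size bound.** No new definitions, no
named facts; nothing here bears on Theorems 1–2 of the source or on Landau–Siegel zeros.

## References

* Y. Zhang, arXiv:2211.02515v1 (2022), §7 Prop. 7.1, §10 (10.12)–(10.16), pp. 57–61.
  [cite: Zhang2022LandauSiegel, §10 (10.12)–(10.16) pp.57–61]
-/

noncomputable section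

open Complex Real ComplexConjugate

namespace Literature.NumberTheory.LFunctions.Zhang2022.Skeleton

/-! ## `𝔞 ≪ 𝓛⁴` -/

section FrakA

variable {D : ℕ} [NeZero D] (χ : DirichletCharacter ℂ D)

/-- **`𝔞 ≤ (96e⁹/π²)𝓛⁴`** for `χ (mod D)` primitive and `𝓛 = log D ≥ 3`: by (2.31)
`𝔞 = (6/π²)L′(1,χ)²∏_{q∣D}q/(q+1)`, the product is `≤ 1`, and `|L′(1,χ)| ≤ 2e^{9/2}(1+𝓛)𝓛 ≤ 4e^{9/2}𝓛²`
(the tree's `Lemma31.norm_deriv_LFunction_le_near_one` at `w = 1`).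
[cite: Zhang2022LandauSiegel, §2 (2.31)] -/
theorem frakA_le_ell_pow_four (hD : 3 ≤ ell D) (hχ : χ.IsPrimitive) :
    frakA χ ≤ 96 * Real.exp 9 / π ^ 2 * ell D ^ 4 := by
  have hL1 : 1 ≤ ell D := by linarith
  have hlog : 3 ≤ Real.log D := by simpa only [ell] using hD
  have hderiv : ‖deriv χ.LFunction 1‖ ≤ 2 * Real.exp (9 / 2) * (1 + ell D) * ell D := by
    have hw : ‖(1 : ℂ) - 1‖ ≤ 1 / Real.log D := by
      rw [sub_self, norm_zero]
      exact div_nonneg zero_le_one (by linarith)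
    have h := Lemma31.norm_deriv_LFunction_le_near_one χ hlog hχ hw
    simpa only [ell] using h
  have hre : |(deriv χ.LFunction 1).re| ≤ 4 * Real.exp (9 / 2) * ell D ^ 2 := by
    refine (Complex.abs_re_le_norm _).trans (hderiv.trans ?_)
    have : (1 + ell D) * ell D ≤ 2 * ell D ^ 2 := by nlinarith
    have h0 : 0 ≤ 2 * Real.exp (9 / 2) := by positivity
    nlinarith
  have hsq : (deriv χ.LFunction 1).re ^ 2 ≤ (4 * Real.exp (9 / 2) * ell D ^ 2) ^ 2 := by
    rw [← sq_abs]
    exact pow_le_pow_left₀ (abs_nonneg _) hre 2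
  have hprod : ∏ p ∈ D.primeFactors, ((p : ℝ) / (p + 1)) ≤ 1 := by
    refine Finset.prod_le_one (fun p _ => by positivity) fun p _ => ?_
    rw [div_le_one (by positivity)]
    linarith
  have hprod0 : 0 ≤ ∏ p ∈ D.primeFactors, ((p : ℝ) / (p + 1)) :=
    Finset.prod_nonneg fun p _ => by positivity
  have hexp : Real.exp (9 / 2) ^ 2 = Real.exp 9 := by
    rw [← Real.exp_nat_mul]; norm_num
  rw [frakA, Lemma171.frakA_def]
  calc 6 / π ^ 2 * (deriv χ.LFunction 1).re ^ 2 * ∏ p ∈ D.primeFactors, ((p : ℝ) / (p + 1))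
      ≤ 6 / π ^ 2 * (4 * Real.exp (9 / 2) * ell D ^ 2) ^ 2 * 1 := by
        gcongr
    _ = 96 * Real.exp 9 / π ^ 2 * ell D ^ 4 := by rw [mul_pow, mul_pow, hexp]; ring

end FrakA

/-! ## Proposition 7.1 + the `Sⱼ` evaluations ⇒ the `Θ₁` evaluations -/

section Generic

variable (c' : ℝ)

/-- `log D ≥ 5` once `D ≥ ⌈e⁵⌉`. [folklore] -/
private theorem five_le_ell {D : ℕ} (hD : ⌈Real.exp 5⌉₊ ≤ D) : 5 ≤ ell D := by
  have h : Real.exp 5 ≤ D := le_trans (Nat.le_ceil _) (by exact_mod_cast hD)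
  rw [ell]
  exact (Real.le_log_iff_exp_le (lt_of_lt_of_le (Real.exp_pos _) h)).mpr h

/-- `log D ≥ X` once `D ≥ ⌈exp X⌉`. [folklore] -/
private theorem le_ell_of_ceilExp_le {X : ℝ} {D : ℕ} (hD : ⌈Real.exp X⌉₊ ≤ D) : X ≤ ell D := by
  have h : Real.exp X ≤ D := le_trans (Nat.le_ceil _) (by exact_mod_cast hD)
  rw [ell]
  exact (Real.le_log_iff_exp_le (lt_of_lt_of_le (Real.exp_pos _) h)).mpr h

/-- `α = π𝓛⁻⁹` ((2.4), `P = exp 𝓛⁹`). [cite: Zhang2022LandauSiegel, §2 (2.4)] -/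
private theorem alpha_eq (D : ℕ) : alpha D = π / ell D ^ 9 := by
  rw [alpha, bigP, Real.log_exp]

/-- From «`α⁻¹S = m𝔞 + O(δ)`»: `|S| ≤ α(|m|𝔞 + δ)` (`α > 0`, `𝔞 ≥ 0`).
[cite: Zhang2022LandauSiegel, §10 p.58] -/
private theorem norm_S_le {D : ℕ} [NeZero D] (χ : DirichletCharacter ℂ D) (hα : 0 < alpha D)
    {S m : ℂ} {δ : ℝ} (h : ‖(alpha D : ℂ)⁻¹ * S - m * frakA χ‖ ≤ δ) :
    ‖S‖ ≤ alpha D * (‖m‖ * frakA χ + δ) := by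
  have hm : ‖m * (frakA χ : ℂ)‖ = ‖m‖ * frakA χ := by
    rw [norm_mul, Complex.norm_real, Real.norm_of_nonneg (frakA_nonneg χ)]
  have h1 : ‖(alpha D : ℂ)⁻¹ * S‖ ≤ ‖m‖ * frakA χ + δ := by
    have := norm_le_norm_add_norm_sub' ((alpha D : ℂ)⁻¹ * S) (m * frakA χ)
    rw [hm] at this
    linarith
  rw [norm_mul, norm_inv, Complex.norm_real, Real.norm_of_nonneg hα.le] at h1
  rwa [inv_mul_le_iff₀ hα] at h1

/-- **Generic §10 step** ("by Proposition 7.1"): Proposition 7.1 (the node `Prop71 c′`), eventual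
admissibility (7.2) of `𝐚₁, 𝐚₂` with a bound `B`, and the three evaluations
«`α⁻¹Sⱼ(𝐚₁,𝐚₂) = mⱼ𝔞 + o(1)`», `j = 1, 2, 3`, give
«`Θ₁(𝐚₁,𝐚₂) = (½m₁ + 2m₂ + 3/2m₃)𝔞𝔓 + o(𝔓)`»: the main term of Prop. 7.1 is
`α⁻¹(½S₁ + 2S₂ + 3/2S₃)𝔓`, and its error `O(𝔓𝓛²Σ|Sⱼ|) + o(𝔓)` is `o(𝔓)` because
`Sⱼ ≪ α𝔞 ≪ 𝓛⁻⁵` (`frakA_le_ell_pow_four`). All hypotheses are CLAIMS of the manuscript.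
[cite: Zhang2022LandauSiegel, §10 (10.12) p.58] -/
theorem theta1_eval_of_prop71 (h71 : Prop71 c') {B : ℝ}
    (a₁ a₂ : (D : ℕ) → [NeZero D] → DirichletCharacter ℂ D → ℕ → ℂ) (m₁ m₂ m₃ : ℂ)
    (hadm : ForAllLarge fun D _ χ => Adm72 D B (a₁ D χ) ∧ Adm72 D B (a₂ D χ))
    (hS1 : ∀ δ : ℝ, 0 < δ → ForAllLarge fun D _ χ => AssumptionA D χ →
      ‖(alpha D : ℂ)⁻¹ * Sj c' D 1 (a₁ D χ) (a₂ D χ) - m₁ * frakA χ‖ ≤ δ)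
    (hS2 : ∀ δ : ℝ, 0 < δ → ForAllLarge fun D _ χ => AssumptionA D χ →
      ‖(alpha D : ℂ)⁻¹ * Sj c' D 2 (a₁ D χ) (a₂ D χ) - m₂ * frakA χ‖ ≤ δ)
    (hS3 : ∀ δ : ℝ, 0 < δ → ForAllLarge fun D _ χ => AssumptionA D χ →
      ‖(alpha D : ℂ)⁻¹ * Sj c' D 3 (a₁ D χ) (a₂ D χ) - m₃ * frakA χ‖ ≤ δ) :
    ∀ ε : ℝ, 0 < ε → ForAllLarge fun D _ χ => AssumptionA D χ →
      ‖Theta1 c' χ (a₁ D χ) (a₂ D χ) - (1 / 2 * m₁ + 2 * m₂ + 3 / 2 * m₃) * frakA χ * frakP D‖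
        ≤ ε * frakP D := by
  intro ε hε
  have hε2 : 0 < ε / 2 := by positivity
  set δ : ℝ := ε / 16 with hδ
  have hδ0 : 0 < δ := by positivity
  obtain ⟨C, hC⟩ := h71 B (ε / 2) hε2
  -- the constants
  set K : ℝ := 96 * Real.exp 9 / π ^ 2 with hK
  set M : ℝ := ‖m₁‖ + ‖m₂‖ + ‖m₃‖ with hM
  set X : ℝ := 4 * (|C| * π * (M * K + 3 * δ)) / ε with hX
  have hK0 : 0 ≤ K := by positivity
  have hM0 : 0 ≤ M := by positivity
  obtain ⟨D₀, h⟩ := ((hC.and hadm).and ((hS1 δ hδ0).and (hS2 δ hδ0))).and (hS3 δ hδ0)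
  refine ⟨max D₀ (max ⌈Real.exp 5⌉₊ ⌈Real.exp X⌉₊), fun D _ χ hD hq hp hA => ?_⟩
  have hD₀ : D₀ ≤ D := le_trans (le_max_left _ _) hD
  have hL5 : 5 ≤ ell D :=
    five_le_ell (le_trans (le_trans (le_max_left _ _) (le_max_right _ _)) hD)
  have hLX : X ≤ ell D :=
    le_ell_of_ceilExp_le (le_trans (le_trans (le_max_right _ _) (le_max_right _ _)) hD)
  have hL1 : 1 ≤ ell D := by linarith
  have hL0 : 0 < ell D := by linarith
  obtain ⟨⟨⟨h71', hadm'⟩, ⟨h1, h2⟩⟩, h3⟩ := h D χ hD₀ hq hp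
  replace h71' := h71' hA (a₁ D χ) (a₂ D χ) hadm'.1 hadm'.2
  replace h1 := h1 hA
  replace h2 := h2 hA
  replace h3 := h3 hA
  have hα : 0 < alpha D := by rw [alpha_eq]; positivity
  have hA0 : 0 ≤ frakA χ := frakA_nonneg χ
  have hP0 : 0 ≤ frakP D := frakP_nonneg D
  have hAle : frakA χ ≤ K * ell D ^ 4 := frakA_le_ell_pow_four χ (by linarith) hp
  -- abbreviations
  set S₁ : ℂ := Sj c' D 1 (a₁ D χ) (a₂ D χ) with hS₁
  set S₂ : ℂ := Sj c' D 2 (a₁ D χ) (a₂ D χ) with hS₂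
  set S₃ : ℂ := Sj c' D 3 (a₁ D χ) (a₂ D χ) with hS₃
  -- (1) the main term of Prop. 7.1 against `m𝔞𝔓`
  have hmain : ‖mainMV c' D (a₁ D χ) (a₂ D χ) -
      (1 / 2 * m₁ + 2 * m₂ + 3 / 2 * m₃) * frakA χ * frakP D‖ ≤ 4 * δ * frakP D := by
    have e : mainMV c' D (a₁ D χ) (a₂ D χ) -
        (1 / 2 * m₁ + 2 * m₂ + 3 / 2 * m₃) * frakA χ * frakP D =
        (1 / 2 * ((alpha D : ℂ)⁻¹ * S₁ - m₁ * frakA χ) + 2 * ((alpha D : ℂ)⁻¹ * S₂ - m₂ * frakA χ) +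
          3 / 2 * ((alpha D : ℂ)⁻¹ * S₃ - m₃ * frakA χ)) * frakP D := by
      rw [mainMV]; ring
    rw [e, norm_mul, Complex.norm_real, Real.norm_of_nonneg hP0]
    have hn : ‖1 / 2 * ((alpha D : ℂ)⁻¹ * S₁ - m₁ * frakA χ) +
        2 * ((alpha D : ℂ)⁻¹ * S₂ - m₂ * frakA χ) +
        3 / 2 * ((alpha D : ℂ)⁻¹ * S₃ - m₃ * frakA χ)‖ ≤ 1 / 2 * δ + 2 * δ + 3 / 2 * δ := by
      refine norm_add₃_le.trans ?_
      rw [norm_mul, norm_mul, norm_mul]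
      have n1 : ‖(1 / 2 : ℂ)‖ = 1 / 2 := by norm_num
      have n2 : ‖(2 : ℂ)‖ = 2 := by norm_num
      have n3 : ‖(3 / 2 : ℂ)‖ = 3 / 2 := by norm_num
      rw [n1, n2, n3]
      gcongr
    calc _ ≤ (1 / 2 * δ + 2 * δ + 3 / 2 * δ) * frakP D := by gcongr
      _ = 4 * δ * frakP D := by ring
  -- (2) the error term `E(𝐚₁,𝐚₂) = 𝔓𝓛²Σ|Sⱼ|` is small
  have hS1' : ‖S₁‖ ≤ alpha D * (‖m₁‖ * frakA χ + δ) := norm_S_le χ hα h1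
  have hS2' : ‖S₂‖ ≤ alpha D * (‖m₂‖ * frakA χ + δ) := norm_S_le χ hα h2
  have hS3' : ‖S₃‖ ≤ alpha D * (‖m₃‖ * frakA χ + δ) := norm_S_le χ hα h3
  have hE : Ecal c' D (a₁ D χ) (a₂ D χ) ≤ π * (M * K + 3 * δ) / ell D * frakP D := by
    rw [Ecal]
    have hsum : ‖S₁‖ + ‖S₂‖ + ‖S₃‖ ≤ alpha D * (M * frakA χ + 3 * δ) := by
      calc ‖S₁‖ + ‖S₂‖ + ‖S₃‖ ≤ alpha D * (‖m₁‖ * frakA χ + δ) + alpha D * (‖m₂‖ * frakA χ + δ) +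
            alpha D * (‖m₃‖ * frakA χ + δ) := by gcongr
        _ = alpha D * (M * frakA χ + 3 * δ) := by rw [hM]; ring
    have hin : M * frakA χ + 3 * δ ≤ (M * K + 3 * δ) * ell D ^ 4 := by
      have h1' : M * frakA χ ≤ M * (K * ell D ^ 4) := by gcongr
      have h4 : 1 ≤ ell D ^ 4 := one_le_pow₀ hL1
      nlinarith
    have hLne : ell D ≠ 0 := hL0.ne'
    calc frakP D * ell D ^ 2 * (‖S₁‖ + ‖S₂‖ + ‖S₃‖)
        ≤ frakP D * ell D ^ 2 * (alpha D * ((M * K + 3 * δ) * ell D ^ 4)) := by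
          gcongr
          exact hsum.trans (by gcongr)
      _ = π * (M * K + 3 * δ) / ell D ^ 3 * frakP D := by
          rw [alpha_eq]; field_simp
      _ ≤ π * (M * K + 3 * δ) / ell D * frakP D :=
          mul_le_mul_of_nonneg_right
            (div_le_div_of_nonneg_left (by positivity) hL0 (le_self_pow₀ hL1 (by norm_num))) hP0
  have hCE : C * Ecal c' D (a₁ D χ) (a₂ D χ) ≤ ε / 4 * frakP D := by
    have hE0 : 0 ≤ Ecal c' D (a₁ D χ) (a₂ D χ) := by
      rw [Ecal]; positivity
    calc C * Ecal c' D (a₁ D χ) (a₂ D χ) ≤ |C| * Ecal c' D (a₁ D χ) (a₂ D χ) := by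
          gcongr; exact le_abs_self C
      _ ≤ |C| * (π * (M * K + 3 * δ) / ell D * frakP D) := by gcongr
      _ = (|C| * π * (M * K + 3 * δ)) / ell D * frakP D := by ring
      _ ≤ ε / 4 * frakP D := by
          refine mul_le_mul_of_nonneg_right ?_ hP0
          rw [div_le_iff₀ hL0]
          have : 4 * (|C| * π * (M * K + 3 * δ)) / ε ≤ ell D := hLX
          rw [div_le_iff₀ hε] at this
          linarith
  -- (3) assemble
  have e : Theta1 c' χ (a₁ D χ) (a₂ D χ) - (1 / 2 * m₁ + 2 * m₂ + 3 / 2 * m₃) * frakA χ * frakP D =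
      (Theta1 c' χ (a₁ D χ) (a₂ D χ) - mainMV c' D (a₁ D χ) (a₂ D χ)) +
        (mainMV c' D (a₁ D χ) (a₂ D χ) -
          (1 / 2 * m₁ + 2 * m₂ + 3 / 2 * m₃) * frakA χ * frakP D) := by ring
  rw [e]
  calc _ ≤ (C * Ecal c' D (a₁ D χ) (a₂ D χ) + ε / 2 * frakP D) + 4 * δ * frakP D :=
        norm_add_le_of_le h71' hmain
    _ ≤ (ε / 4 * frakP D + ε / 2 * frakP D) + 4 * (ε / 16) * frakP D := by rw [hδ]; gcongr
    _ = ε * frakP D := by ring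

end Generic

/-! ## The instance (10.12) -/

section Instances

variable (c' : ℝ)

/-- Admissibility (7.2) of two of the §§8–10 sequences, eventually, with a common bound.
[cite: Zhang2022LandauSiegel, §7 (7.2)] -/
private theorem adm_pair {B₁ B₂ : ℝ}
    (a₁ a₂ : (D : ℕ) → [NeZero D] → DirichletCharacter ℂ D → ℕ → ℂ)
    (h₁ : ∀ (D : ℕ) [NeZero D] (χ : DirichletCharacter ℂ D), 5 ≤ Real.log D →
      Adm72 D B₁ (a₁ D χ))
    (h₂ : ∀ (D : ℕ) [NeZero D] (χ : DirichletCharacter ℂ D), 5 ≤ Real.log D →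
      Adm72 D B₂ (a₂ D χ)) :
    ForAllLarge fun D _ χ => Adm72 D (max B₁ B₂) (a₁ D χ) ∧ Adm72 D (max B₁ B₂) (a₂ D χ) := by
  refine ⟨⌈Real.exp 5⌉₊, fun D _ χ hD _ _ => ?_⟩
  have hL5 : 5 ≤ Real.log D := by
    have h : Real.exp 5 ≤ D := le_trans (Nat.le_ceil _) (by exact_mod_cast hD)
    exact (Real.le_log_iff_exp_le (lt_of_lt_of_le (Real.exp_pos _) h)).mpr h
  exact ⟨adm72_mono (le_max_left _ _) (h₁ D χ hL5), adm72_mono (le_max_right _ _) (h₂ D χ hL5)⟩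

/-- **`Z22:(10.12)` DISCHARGED as a deduction** (§10 p. 58, tex L2951–2959: «`α⁻¹Sⱼ(𝐚₁₁,𝐚₁₃) =
d₃ⱼ𝔞 + o(1)` … Inserting these results into Proposition 7.1 we obtain
`Θ₁(𝐚₁₁,𝐚₁₃) = (½d₃₁ + 2d₃₂ + 3/2d₃₃)𝔞𝔓 + o(𝔓)` (10.12)»): from `Prop71 c′` and the three `Sⱼ`
evaluations (explicit hypotheses; CLAIMS of the manuscript, DAG node `Z22:§10.u040`).
[cite: Zhang2022LandauSiegel, §10 (10.12) p.58] -/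
theorem eq1012_of (h71 : Prop71 c')
    (hS1 : ∀ δ : ℝ, 0 < δ → ForAllLarge fun D _ χ => AssumptionA D χ →
      ‖(alpha D : ℂ)⁻¹ * Sj c' D 1 (a11 χ) (a13 χ) - d31 * frakA χ‖ ≤ δ)
    (hS2 : ∀ δ : ℝ, 0 < δ → ForAllLarge fun D _ χ => AssumptionA D χ →
      ‖(alpha D : ℂ)⁻¹ * Sj c' D 2 (a11 χ) (a13 χ) - d32 * frakA χ‖ ≤ δ)
    (hS3 : ∀ δ : ℝ, 0 < δ → ForAllLarge fun D _ χ => AssumptionA D χ →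
      ‖(alpha D : ℂ)⁻¹ * Sj c' D 3 (a11 χ) (a13 χ) - d33 * frakA χ‖ ≤ δ) :
    ∀ ε : ℝ, 0 < ε → ForAllLarge fun D _ χ => AssumptionA D χ →
      ‖Theta1 c' χ (a11 χ) (a13 χ) - (1 / 2 * d31 + 2 * d32 + 3 / 2 * d33) * frakA χ * frakP D‖
        ≤ ε * frakP D :=
  theta1_eval_of_prop71 c' h71 (fun D _ χ => a11 χ) (fun D _ χ => a13 χ) d31 d32 d33
    (adm_pair _ _ (fun D _ χ h => adm72_a11 χ (by linarith)) (fun D _ χ h => adm72_a13 χ (by linarith)))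
    hS1 hS2 hS3

end Instances

/-! ## Restored declarations of p412375 (seat sz-d43)

The nine declarations below were landed by seat sz-d43 (proposal p412375, commit e3adfb88822d) and
then removed when the present file was re-landed whole by another seat (p412421; a filing collision —
both seats wrote `Section10Theta1Evals.lean`). They are restored here with their landed SIGNATURES
VERBATIM (names, binders, statements), so that every consumer of p412375 elaborates unchanged; the
proofs route through `theta1_eval_of_prop71` above where convenient. The one signature that cannot be
restored under its name is sz-d43's `frakA_le_ell_pow_four : … ≤ 16·e⁹·𝓛⁴` (the name now carries the
bound `(96e⁹/π²)𝓛⁴ ≤ 16e⁹𝓛⁴`); it is restored as the corollary `frakA_le_ell_pow_four'`.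
[cite: Zhang2022LandauSiegel, §10 (10.12)–(10.16) pp.57–61] -/

section RestoredD43

variable {c' : ℝ}

/-- `log D ≥ 2` once `D ≥ 8`. [folklore] -/
private theorem two_le_log_of_eight_le {D : ℕ} (hD : 8 ≤ D) : 2 ≤ Real.log D := by
  have h8 : (8 : ℝ) ≤ D := by exact_mod_cast hD
  have h2 : (2 : ℝ) ≤ Real.log 8 := by
    rw [Real.le_log_iff_exp_le (by norm_num)]
    have h1 := Real.exp_one_lt_d9
    have h0 := Real.exp_pos 1
    have hsq : Real.exp 2 = Real.exp 1 * Real.exp 1 := by rw [← Real.exp_add]; norm_num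
    rw [hsq]
    nlinarith
  exact h2.trans (Real.log_le_log (by norm_num) h8)

/-- `log D ≥ 5` once `D ≥ 256` (`e⁵ < 149`). [folklore] -/
private theorem five_le_log_of_le {D : ℕ} (hD : 256 ≤ D) : 5 ≤ Real.log D := by
  have h256 : (256 : ℝ) ≤ D := by exact_mod_cast hD
  have h5 : (5 : ℝ) ≤ Real.log 256 := by
    rw [Real.le_log_iff_exp_le (by norm_num)]
    have h1 := Real.exp_one_lt_d9
    have h0 := Real.exp_pos 1
    have h5e : Real.exp 5 = Real.exp 1 * Real.exp 1 * Real.exp 1 * Real.exp 1 * Real.exp 1 := by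
      rw [← Real.exp_add, ← Real.exp_add, ← Real.exp_add, ← Real.exp_add]; norm_num
    rw [h5e]
    nlinarith [mul_pos h0 h0, mul_pos (mul_pos h0 h0) h0, mul_pos (mul_pos (mul_pos h0 h0) h0) h0]
  exact h5.trans (Real.log_le_log (by norm_num) h256)

/-- **`𝔞 ≤ 16e⁹𝓛⁴`** (sz-d43's form of `frakA_le_ell_pow_four`, p412375): since `96/π² ≤ 16`.
[cite: Zhang2022LandauSiegel, §2 (2.31)] -/
theorem frakA_le_ell_pow_four' {D : ℕ} [NeZero D] (χ : DirichletCharacter ℂ D) (hL : 3 ≤ ell D)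
    (hp : χ.IsPrimitive) : frakA χ ≤ 16 * Real.exp 9 * ell D ^ 4 := by
  refine (frakA_le_ell_pow_four χ hL hp).trans ?_
  have hπ : 96 / π ^ 2 ≤ (16 : ℝ) := by
    rw [div_le_iff₀ (by positivity)]
    nlinarith [Real.pi_gt_three]
  have h0 : 0 ≤ Real.exp 9 * ell D ^ 4 := by
    have : 0 ≤ ell D := by linarith
    positivity
  calc 96 * Real.exp 9 / π ^ 2 * ell D ^ 4 = 96 / π ^ 2 * (Real.exp 9 * ell D ^ 4) := by ring
    _ ≤ 16 * (Real.exp 9 * ell D ^ 4) := by gcongr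
    _ = 16 * Real.exp 9 * ell D ^ 4 := by ring

/-- `E(𝐚₁,𝐚₂) = 𝔓𝓛²Σ|S_j| ≥ 0` (restored, p412375). [cite: Zhang2022LandauSiegel, §7 Prop. 7.1] -/
theorem Ecal_nonneg (c' : ℝ) (D : ℕ) (a₁ a₂ : ℕ → ℂ) : 0 ≤ Ecal c' D a₁ a₂ := by
  rw [Ecal]
  have := frakP_nonneg D
  positivity

/-- **Generic «by Proposition 7.1» consumer, main-term form** (restored, p412375, sz-d43): Prop. 7.1,
eventual admissibility of `𝐚₁, 𝐚₂`, «`mainMV = c𝔞𝔓 + o(𝔓)`» and «`E(𝐚₁,𝐚₂) = o(𝔓)`» give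
«`Θ₁(𝐚₁,𝐚₂) = c𝔞𝔓 + o(𝔓)`». All hypotheses are CLAIMS of the manuscript.
[cite: Zhang2022LandauSiegel, §7 Prop. 7.1, §10 (10.12)–(10.16)] -/
theorem theta1_eval_of_mainMV (h71 : Prop71 c') {B : ℝ}
    {a₁ a₂ : ∀ (D : ℕ) [NeZero D], DirichletCharacter ℂ D → ℕ → ℂ} {c : ℂ}
    (hadm : ForAllLarge fun D _ χ => Adm72 D B (a₁ D χ) ∧ Adm72 D B (a₂ D χ))
    (hmain : ∀ ε : ℝ, 0 < ε → ForAllLarge fun D _ χ => AssumptionA D χ →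
      ‖mainMV c' D (a₁ D χ) (a₂ D χ) - c * frakA χ * frakP D‖ ≤ ε * frakP D)
    (hE : ∀ ε : ℝ, 0 < ε → ForAllLarge fun D _ χ => AssumptionA D χ →
      Ecal c' D (a₁ D χ) (a₂ D χ) ≤ ε * frakP D) :
    ∀ ε : ℝ, 0 < ε → ForAllLarge fun D _ χ => AssumptionA D χ →
      ‖Theta1 c' χ (a₁ D χ) (a₂ D χ) - c * frakA χ * frakP D‖ ≤ ε * frakP D := by
  intro ε hε
  have hε3 : 0 < ε / 3 := by positivity
  obtain ⟨C, hC⟩ := h71 B (ε / 3) hε3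
  have hε' : 0 < ε / 3 / (|C| + 1) := by positivity
  refine (((hC.and hadm).and (hmain (ε / 3) hε3)).and (hE _ hε')).mono
    fun D _ χ _ _ h hA => ?_
  obtain ⟨⟨⟨h1, h2⟩, h3⟩, h4⟩ := h
  replace h1 := h1 hA (a₁ D χ) (a₂ D χ) h2.1 h2.2
  replace h3 := h3 hA
  replace h4 := h4 hA
  have hP0 : 0 ≤ frakP D := frakP_nonneg D
  have hE0 : 0 ≤ Ecal c' D (a₁ D χ) (a₂ D χ) := Ecal_nonneg c' D _ _
  have hCE : C * Ecal c' D (a₁ D χ) (a₂ D χ) ≤ ε / 3 * frakP D := by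
    calc C * Ecal c' D (a₁ D χ) (a₂ D χ) ≤ |C| * Ecal c' D (a₁ D χ) (a₂ D χ) := by
          gcongr; exact le_abs_self C
      _ ≤ |C| * (ε / 3 / (|C| + 1) * frakP D) := by gcongr
      _ = (|C| / (|C| + 1)) * (ε / 3 * frakP D) := by ring
      _ ≤ 1 * (ε / 3 * frakP D) := by
          refine mul_le_mul_of_nonneg_right ?_ (by positivity)
          rw [div_le_one (by positivity)]; linarith [abs_nonneg C]
      _ = ε / 3 * frakP D := one_mul _
  have e : Theta1 c' χ (a₁ D χ) (a₂ D χ) - c * frakA χ * frakP D =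
      (Theta1 c' χ (a₁ D χ) (a₂ D χ) - mainMV c' D (a₁ D χ) (a₂ D χ)) +
        (mainMV c' D (a₁ D χ) (a₂ D χ) - c * frakA χ * frakP D) := by ring
  rw [e]
  calc _ ≤ (C * Ecal c' D (a₁ D χ) (a₂ D χ) + ε / 3 * frakP D) + ε / 3 * frakP D :=
        norm_add_le_of_le h1 h3
    _ ≤ (ε / 3 * frakP D + ε / 3 * frakP D) + ε / 3 * frakP D := by gcongr
    _ = ε * frakP D := by ring

/-- **Generic «by Proposition 7.1» consumer, per-`j` form** (restored, p412375, sz-d43): Prop. 7.1,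
eventual admissibility, and the three claims «`α⁻¹Sⱼ(𝐚₁,𝐚₂) = δⱼ𝔞 + o(1)`» give
«`Θ₁(𝐚₁,𝐚₂) = (½δ₁ + 2δ₂ + 3/2δ₃)𝔞𝔓 + o(𝔓)`» (here via `theta1_eval_of_prop71`).
[cite: Zhang2022LandauSiegel, §7 Prop. 7.1, §10 (10.12)–(10.16)] -/
theorem theta1_eval_of_sj (h71 : Prop71 c') {B : ℝ}
    {a₁ a₂ : ∀ (D : ℕ) [NeZero D], DirichletCharacter ℂ D → ℕ → ℂ} (δ₁ δ₂ δ₃ : ℂ)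
    (hadm : ForAllLarge fun D _ χ => Adm72 D B (a₁ D χ) ∧ Adm72 D B (a₂ D χ))
    (hS1 : ∀ ε : ℝ, 0 < ε → ForAllLarge fun D _ χ => AssumptionA D χ →
      ‖(alpha D : ℂ)⁻¹ * Sj c' D 1 (a₁ D χ) (a₂ D χ) - δ₁ * frakA χ‖ ≤ ε)
    (hS2 : ∀ ε : ℝ, 0 < ε → ForAllLarge fun D _ χ => AssumptionA D χ →
      ‖(alpha D : ℂ)⁻¹ * Sj c' D 2 (a₁ D χ) (a₂ D χ) - δ₂ * frakA χ‖ ≤ ε)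
    (hS3 : ∀ ε : ℝ, 0 < ε → ForAllLarge fun D _ χ => AssumptionA D χ →
      ‖(alpha D : ℂ)⁻¹ * Sj c' D 3 (a₁ D χ) (a₂ D χ) - δ₃ * frakA χ‖ ≤ ε) :
    ∀ ε : ℝ, 0 < ε → ForAllLarge fun D _ χ => AssumptionA D χ →
      ‖Theta1 c' χ (a₁ D χ) (a₂ D χ) -
          (1 / 2 * δ₁ + 2 * δ₂ + 3 / 2 * δ₃) * frakA χ * frakP D‖ ≤ ε * frakP D :=
  theta1_eval_of_prop71 c' h71 a₁ a₂ δ₁ δ₂ δ₃ hadm hS1 hS2 hS3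

/-- Admissibility (7.2) of `𝐚₁₃, 𝐚₂₁` with the common bound `1 + |ι₂|`, for `D ≥ 8` (restored,
p412375; the tree's `adm72_a13`, `adm72_a21`). [cite: Zhang2022LandauSiegel, §7 (7.2), §10 p. 20] -/
theorem adm72_a13_a21 :
    ForAllLarge fun D _ χ => Adm72 D (1 + ‖iota2‖) (a13 χ) ∧ Adm72 D (1 + ‖iota2‖) (a21 χ) := by
  refine ForAllLarge.of_le 8 fun D _ χ hD _ _ => ?_
  have hlog := two_le_log_of_eight_le hD
  exact ⟨adm72_mono (le_add_of_nonneg_right (norm_nonneg _)) (adm72_a13 χ hlog), adm72_a21 χ hlog⟩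

/-- Admissibility (7.2) of `𝐚₁₄, 𝐚₂₂` with the common bound `1 + |ι₃| + |ι₄|`, for `D ≥ 256`
(restored, p412375; the tree's `adm72_a14`, `adm72_a22`). [cite: Zhang2022LandauSiegel, §7 (7.2), §10 p. 20] -/
theorem adm72_a14_a22 :
    ForAllLarge fun D _ χ =>
      Adm72 D (1 + ‖iota3‖ + ‖iota4‖) (a14 χ) ∧ Adm72 D (1 + ‖iota3‖ + ‖iota4‖) (a22 χ) := by
  refine ForAllLarge.of_le 256 fun D _ χ hD _ _ => ?_
  have hlog5 := five_le_log_of_le hD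
  have hlog2 : 2 ≤ Real.log D := by linarith
  have h3 := norm_nonneg iota3
  have h4 := norm_nonneg iota4
  exact ⟨adm72_mono (by linarith) (adm72_a14 χ hlog5),
    adm72_mono (by linarith) (adm72_a22 χ hlog2)⟩

/-- Admissibility (7.2) of `𝐚₁₂, 𝐚₁₄` with the common bound `1 + |ι₃| + |ι₄|`, for `D ≥ 256`
(restored, p412375; the tree's `adm72_a12`, `adm72_a14`). [cite: Zhang2022LandauSiegel, §7 (7.2), §10 p. 20] -/
theorem adm72_a12_a14 :
    ForAllLarge fun D _ χ =>
      Adm72 D (1 + ‖iota3‖ + ‖iota4‖) (a12 χ) ∧ Adm72 D (1 + ‖iota3‖ + ‖iota4‖) (a14 χ) := by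
  refine ForAllLarge.of_le 256 fun D _ χ hD _ _ => ?_
  have hlog5 := five_le_log_of_le hD
  have hlog2 : 2 ≤ Real.log D := by linarith
  have h3 := norm_nonneg iota3
  have h4 := norm_nonneg iota4
  exact ⟨adm72_mono (by linarith) (adm72_a12 χ hlog2),
    adm72_mono (by linarith) (adm72_a14 χ hlog5)⟩

/-- **`Z22:(10.13)` as a DED step** (restored, p412375, sz-d43) [Z22 p.59, (10.13), tex L3008–3012]:
"Hence, by Proposition 7.1, `Θ₁(𝐚₁₃,𝐚₂₁) = (½d₄₁ + 2d₄₂ + 3/2d₄₃)𝔞𝔓 + o(𝔓)`" FOLLOWS from the node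
`Prop71 c′` and the three printed evaluations "`α⁻¹S_j(𝐚₁₃,𝐚₂₁) = d₄ⱼ𝔞 + o(1)`" (CLAIMS, hypotheses).
[cite: Zhang2022LandauSiegel, §10 (10.13)] -/
theorem eq1013_of_sj (h71 : Prop71 c')
    (hS1 : ∀ ε : ℝ, 0 < ε → ForAllLarge fun D _ χ => AssumptionA D χ →
      ‖(alpha D : ℂ)⁻¹ * Sj c' D 1 (a13 χ) (a21 χ) - d41 * frakA χ‖ ≤ ε)
    (hS2 : ∀ ε : ℝ, 0 < ε → ForAllLarge fun D _ χ => AssumptionA D χ →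
      ‖(alpha D : ℂ)⁻¹ * Sj c' D 2 (a13 χ) (a21 χ) - d42 * frakA χ‖ ≤ ε)
    (hS3 : ∀ ε : ℝ, 0 < ε → ForAllLarge fun D _ χ => AssumptionA D χ →
      ‖(alpha D : ℂ)⁻¹ * Sj c' D 3 (a13 χ) (a21 χ) - d43 * frakA χ‖ ≤ ε) :
    ∀ ε : ℝ, 0 < ε → ForAllLarge fun D _ χ => AssumptionA D χ →
      ‖Theta1 c' χ (a13 χ) (a21 χ) - (1 / 2 * d41 + 2 * d42 + 3 / 2 * d43) * frakA χ * frakP D‖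
        ≤ ε * frakP D :=
  theta1_eval_of_sj (a₁ := fun _ _ χ => a13 χ) (a₂ := fun _ _ χ => a21 χ) h71 d41 d42 d43
    adm72_a13_a21 hS1 hS2 hS3

/-- **`Z22:(10.14)` as a DED step** (restored, p412375, sz-d43) [Z22 p.60, (10.14), tex L3072–3076]:
"Hence, by Proposition 7.1, `Θ₁(𝐚₁₄,𝐚₂₂) = (½(d′₅₁+d₅₁) + 2(d′₅₂+d₅₂) + 3/2(d′₅₃+d₅₃))𝔞𝔓 + o(𝔓)`"
FOLLOWS from `Prop71 c′` and the three printed evaluations "`α⁻¹S_j(𝐚₁₄,𝐚₂₂) = (d′₅ⱼ + d₅ⱼ)𝔞 + o(1)`"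
(CLAIMS, hypotheses). [cite: Zhang2022LandauSiegel, §10 (10.14)] -/
theorem eq1014_of_sj (h71 : Prop71 c')
    (hS1 : ∀ ε : ℝ, 0 < ε → ForAllLarge fun D _ χ => AssumptionA D χ →
      ‖(alpha D : ℂ)⁻¹ * Sj c' D 1 (a14 χ) (a22 χ) - (d5p1 + d51) * frakA χ‖ ≤ ε)
    (hS2 : ∀ ε : ℝ, 0 < ε → ForAllLarge fun D _ χ => AssumptionA D χ →
      ‖(alpha D : ℂ)⁻¹ * Sj c' D 2 (a14 χ) (a22 χ) - (d5p2 + d52) * frakA χ‖ ≤ ε)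
    (hS3 : ∀ ε : ℝ, 0 < ε → ForAllLarge fun D _ χ => AssumptionA D χ →
      ‖(alpha D : ℂ)⁻¹ * Sj c' D 3 (a14 χ) (a22 χ) - (d5p3 + d53) * frakA χ‖ ≤ ε) :
    ∀ ε : ℝ, 0 < ε → ForAllLarge fun D _ χ => AssumptionA D χ →
      ‖Theta1 c' χ (a14 χ) (a22 χ) -
          (1 / 2 * (d5p1 + d51) + 2 * (d5p2 + d52) + 3 / 2 * (d5p3 + d53)) * frakA χ * frakP D‖
        ≤ ε * frakP D :=
  theta1_eval_of_sj (a₁ := fun _ _ χ => a14 χ) (a₂ := fun _ _ χ => a22 χ) h71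
    (d5p1 + d51) (d5p2 + d52) (d5p3 + d53) adm72_a14_a22 hS1 hS2 hS3

/-- **`Z22:(10.16)` as a DED step** (restored, p412375, sz-d43) [Z22 p.61, (10.16), tex L3143–3147]:
"Hence, by Proposition 7.1, `Θ₁(𝐚₁₂,𝐚₁₄) = (½(d′₆₁+d₆₁) + 2(d′₆₂+d₆₂) + 3/2(d′₆₃+d₆₃))𝔞𝔓 + o(𝔓)`"
(printed `3/2d′₆₃ + d₆₃)`, read as `3/2(d′₆₃ + d₆₃)` like `Section10Defs.dfrak`) FOLLOWS from
`Prop71 c′` and the three printed evaluations "`α⁻¹S_j(𝐚₁₂,𝐚₁₄) = (d′₆ⱼ + d₆ⱼ)𝔞 + o(1)`" (CLAIMS,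
hypotheses). [cite: Zhang2022LandauSiegel, §10 (10.16)] -/
theorem eq1016_of_sj (h71 : Prop71 c')
    (hS1 : ∀ ε : ℝ, 0 < ε → ForAllLarge fun D _ χ => AssumptionA D χ →
      ‖(alpha D : ℂ)⁻¹ * Sj c' D 1 (a12 χ) (a14 χ) - (d6p1 + d61) * frakA χ‖ ≤ ε)
    (hS2 : ∀ ε : ℝ, 0 < ε → ForAllLarge fun D _ χ => AssumptionA D χ →
      ‖(alpha D : ℂ)⁻¹ * Sj c' D 2 (a12 χ) (a14 χ) - (d6p2 + d62) * frakA χ‖ ≤ ε)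
    (hS3 : ∀ ε : ℝ, 0 < ε → ForAllLarge fun D _ χ => AssumptionA D χ →
      ‖(alpha D : ℂ)⁻¹ * Sj c' D 3 (a12 χ) (a14 χ) - (d6p3 + d63) * frakA χ‖ ≤ ε) :
    ∀ ε : ℝ, 0 < ε → ForAllLarge fun D _ χ => AssumptionA D χ →
      ‖Theta1 c' χ (a12 χ) (a14 χ) -
          (1 / 2 * (d6p1 + d61) + 2 * (d6p2 + d62) + 3 / 2 * (d6p3 + d63)) * frakA χ * frakP D‖
        ≤ ε * frakP D :=
  theta1_eval_of_sj (a₁ := fun _ _ χ => a12 χ) (a₂ := fun _ _ χ => a14 χ) h71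
    (d6p1 + d61) (d6p2 + d62) (d6p3 + d63) adm72_a12_a14 hS1 hS2 hS3

end RestoredD43

end Literature.NumberTheory.LFunctions.Zhang2022.Skeleton
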